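import Summits.QuantumFields.BalabanUV.Beta.FP.LatticeTaylor

/-!
# `BalabanUV.Beta.FP.LatticeTaylorPath` — DISCRETE TAYLOR EXPANSIONS ON `ℤ^D` TO ORDER TWO ALONG THE COORDINATE PATH, THIRD-DIFFERENCE REMAINDERS
# (road «FP» for binder row D1, LEGS generic Taylor-pairing track, module (T) part 2; [folklore] discrete calculus, nothing of the manuscripts)

HONEST DEPENDENCY (page 1, mandatory): continuum YM on T⁴ ⇐ BetaPertH ∧ nine spine estimates (0/9 proved); BetaPertH ⇐ (D1) ∧ (D4) ∧
CAP+tail; G-an2-4 gates asym, D1 and NE2/3/4.  HONEST FRAMING (cell contract, verbatim): «discharging `BetaPertH` makes Bałaban's UV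
stability UNCONDITIONAL — a real constructive-QFT result; it is NOT the continuum limit and NOT the Clay problem.»  THIS MODULE is elementary
[folklore] real analysis on the integer lattice; it asserts nothing about Bałaban's objects, cites nothing, mints no `Prop` fact, one DATA `def` (`trunc`, the
displacement truncated to the first `k` coordinates — the coordinate path), 0 sorry.  Value = the Taylor half of the LEGS row of road FP's N7 (`REP-DESIGN.md` (P3)):
exponentially localised stencil profiles are paired against legs expanded to SECOND order in the lattice variables, the THIRD-order remainder being summable in the
window.  NOT D1, NOT BetaPertH, NOT continuum, NOT Clay.

WHAT IS HERE (over `FP/LatticeTaylor`'s one-dimensional bounds `abs_taylor0/1/2_le`).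
* §2 the coordinate path: `trunc k s` (`s` truncated to the coordinates `< k`; `trunc 0 s = 0`, `trunc D s = s`, `trunc (k+1) s = trunc k s + s_k • e_k`,
  `e_k = Pi.single k 1`), the LINE RESTRICTION lemmas (`Δ_[1] (j ↦ f (q + j•v)) = j ↦ Δ_[v] f (q + j•v)`, iterated), and `path_mem_box` (every path point
  `p + trunc k s + j•e_k`, `j` between `0` and `s_k`, is coordinatewise within `R` of `p` when all `|s_i| ≤ R`);
* §3 the BOUNDS, forward differences AT THE BASE POINT only, for `f : ℤ^D → ℝ`, base `p`, displacement `s` with `|s_i| ≤ R`, and a bound `B` on ALL differences of the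
  relevant order on the coordinate box of radius `R` around `p`:
  `abs_taylor0D_le`: `|f (p+s) − f p| ≤ D·R·B` (first differences);
  `abs_taylor1D_le`: `|f (p+s) − f p − Σ_i s_i Δ_i f p| ≤ D(D+1)·R²·B` (second differences);
  `abs_taylor2D_le`: `|f (p+s) − f p − Σ_k s_k Δ_k f p − Σ_k (s_k(s_k−1)/2) Δ_kΔ_k f p − Σ_k Σ_i s_k (trunc k s)_i Δ_iΔ_k f p| ≤ D(D+1)²·R³·B` (third differences;
  the mixed term runs over `i < k`, encoded by `trunc`).
NOT HERE: stencil moments, the bubble pairing, the `‖w‖⁻⁷` remainder (next modules of the track).  Unit `b2b-balaban-beta-d1-formalise-leaf-02` (gen 5).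
-/

noncomputable section

namespace Summit.QuantumFields.BalabanUV.Beta.FP.LatticeTaylorPath

open Finset fwdDiff
open Summit.QuantumFields.BalabanUV.Beta.FP.LatticeTaylor

/-! ## §2 Several dimensions: coordinate paths, truncated displacements, line restrictions -/

section MultiDim

variable {D : ℕ}

/-- [folklore] The displacement TRUNCATED to the first `k` coordinates: `(trunc k s) i = s i` if `i < k`, else `0`. -/
def trunc (k : ℕ) (s : Fin D → ℤ) : Fin D → ℤ := fun i => if (i : ℕ) < k then s i else 0

/-- [folklore] Unfolding of `trunc`. -/
@[simp] theorem trunc_apply (k : ℕ) (s : Fin D → ℤ) (i : Fin D) : trunc k s i = if (i : ℕ) < k then s i else 0 := rfl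

/-- [folklore] Nothing truncated at `k = 0`. -/
@[simp] theorem trunc_zero (s : Fin D → ℤ) : trunc 0 s = 0 := by
  funext i; simp [trunc]

/-- [folklore] Everything kept at `k = D`. -/
@[simp] theorem trunc_self (s : Fin D → ℤ) : trunc D s = s := by
  funext i; simp [trunc, i.isLt]

/-- [folklore] One more coordinate: `trunc (k+1) s = trunc k s + s_k • e_k` (`k < D`). -/
theorem trunc_succ (s : Fin D → ℤ) (k : Fin D) : trunc ((k : ℕ) + 1) s = trunc k s + s k • Pi.single k (1 : ℤ) := by
  funext i
  simp only [trunc, Pi.add_apply, Pi.smul_apply, Pi.single_apply, smul_eq_mul]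
  by_cases hik : i = k
  · subst hik; simp
  · have hne : (i : ℕ) ≠ (k : ℕ) := fun h => hik (Fin.ext h)
    simp only [hik, if_false, mul_zero, add_zero]
    by_cases hlt : (i : ℕ) < (k : ℕ)
    · simp [hlt, Nat.lt_succ_of_lt hlt]
    · have : ¬ (i : ℕ) < (k : ℕ) + 1 := by omega
      simp [hlt, this]

/-- [folklore] Truncation beyond `D` keeps everything. -/
theorem trunc_of_le (s : Fin D → ℤ) {k : ℕ} (hk : D ≤ k) : trunc k s = s := by
  funext i; simp [trunc, lt_of_lt_of_le i.isLt hk]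

/-- [folklore] Truncated coordinates are bounded by the originals. -/
theorem abs_trunc_le (k : ℕ) (s : Fin D → ℤ) (i : Fin D) : |trunc k s i| ≤ |s i| := by
  simp only [trunc_apply]; split_ifs <;> simp

/-- [folklore] THE LINE RESTRICTION: forward differences of `j ↦ f (q + j • v)` are the directional forward differences of `f` along `v`. -/
theorem fwdDiff_line (f : (Fin D → ℤ) → ℝ) (q v : Fin D → ℤ) :
    Δ_[1] (fun j : ℤ => f (q + j • v)) = fun j : ℤ => Δ_[v] f (q + j • v) := by
  funext j
  simp only [fwdDiff, add_smul, one_smul, add_assoc]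

/-- [folklore] Iterated line restriction (second differences). -/
theorem fwdDiff_fwdDiff_line (f : (Fin D → ℤ) → ℝ) (q v : Fin D → ℤ) :
    Δ_[1] (Δ_[1] (fun j : ℤ => f (q + j • v))) = fun j : ℤ => Δ_[v] (Δ_[v] f) (q + j • v) := by
  rw [fwdDiff_line, fwdDiff_line (Δ_[v] f)]

/-- [folklore] Iterated line restriction (third differences). -/
theorem fwdDiff_fwdDiff_fwdDiff_line (f : (Fin D → ℤ) → ℝ) (q v : Fin D → ℤ) :
    Δ_[1] (Δ_[1] (Δ_[1] (fun j : ℤ => f (q + j • v)))) = fun j : ℤ => Δ_[v] (Δ_[v] (Δ_[v] f)) (q + j • v) := by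
  rw [fwdDiff_fwdDiff_line, fwdDiff_line (Δ_[v] (Δ_[v] f))]

/-- [folklore] THE PATH STAYS IN THE BOX: every point `p + trunc k s + j • e_k` with `j` between `0` and `s_k` is coordinatewise within `R` of `p`
when `|s_i| ≤ R` for all `i`. -/
theorem path_mem_box {p s : Fin D → ℤ} {R : ℕ} (hs : ∀ i, |s i| ≤ R) (k : Fin D) {j : ℤ}
    (hj1 : min (s k) 0 ≤ j) (hj2 : j ≤ max (s k) 0) (i : Fin D) :
    |(p + trunc k s + j • (Pi.single k 1 : Fin D → ℤ)) i - p i| ≤ R := by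
  simp only [Pi.add_apply, Pi.smul_apply, Pi.single_apply, smul_eq_mul, trunc_apply]
  have hk := hs k
  have hi := hs i
  by_cases hik : i = k
  · subst hik
    simp only [lt_irrefl, if_false, if_true, mul_one]
    rw [show p i + 0 + j - p i = j by ring]
    rw [abs_le] at hk ⊢
    rcases le_total (s i) 0 with h0 | h0
    · rw [min_eq_left h0, max_eq_right h0] at *; constructor <;> omega
    · rw [min_eq_right h0, max_eq_left h0] at *; constructor <;> omega
  · simp only [hik, if_false, mul_zero, add_zero]
    split_ifs
    · rw [show p i + s i - p i = s i by ring]; exact hi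
    · simp

end MultiDim


/-! ## §3 Several dimensions: Taylor bounds of orders zero, one and two along the coordinate path -/

section MultiBounds

variable {D : ℕ} (f : (Fin D → ℤ) → ℝ) (p s : Fin D → ℤ)

/-- [folklore] Telescoping along the coordinate path: `f (p + s) − f p = Σ_{k<D} (f (p + trunc (k+1) s) − f (p + trunc k s))`. -/
theorem sub_eq_sum_path : f (p + s) - f p = ∑ k ∈ range D, (f (p + trunc (k + 1) s) - f (p + trunc k s)) := by
  rw [Finset.sum_range_sub (fun k => f (p + trunc k s)), trunc_self, trunc_zero, add_zero]

/-- [folklore] One step of the path is a one-dimensional increment along `e_k` with integer step `s_k` from the base `p + trunc k s`. -/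
theorem path_step_eq (k : Fin D) :
    f (p + trunc ((k : ℕ) + 1) s) - f (p + trunc k s)
      = (fun j : ℤ => f (p + trunc k s + j • (Pi.single k 1 : Fin D → ℤ))) (s k)
        - (fun j : ℤ => f (p + trunc k s + j • (Pi.single k 1 : Fin D → ℤ))) 0 := by
  simp only [trunc_succ, zero_smul, add_zero, add_assoc]

/-- **ZEROTH-ORDER BOUND ON `ℤ^D`**: if every first difference of `f` is bounded by `B` on the coordinate box of radius `R` around `p` and
`|s_i| ≤ R`, then `|f (p + s) − f p| ≤ D·R·B`. [folklore] -/
theorem abs_taylor0D_le {R : ℕ} (hs : ∀ i, |s i| ≤ (R : ℤ)) {B : ℝ} (hB : 0 ≤ B)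
    (h : ∀ x : Fin D → ℤ, (∀ i, |x i - p i| ≤ (R : ℤ)) → ∀ i : Fin D, |Δ_[(Pi.single i 1 : Fin D → ℤ)] f x| ≤ B) :
    |f (p + s) - f p| ≤ (D : ℝ) * (R : ℝ) * B := by
  rw [sub_eq_sum_path]
  refine (abs_sum_le_sum_abs _ _).trans ?_
  have hk : ∀ k ∈ range D, |f (p + trunc (k + 1) s) - f (p + trunc k s)| ≤ (R : ℝ) * B := by
    intro k hk
    have hkD : k < D := mem_range.mp hk
    have e := path_step_eq f p s ⟨k, hkD⟩
    rw [e]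
    refine (abs_taylor0_le (fun j : ℤ => f (p + trunc k s + j • (Pi.single (⟨k, hkD⟩ : Fin D) 1 : Fin D → ℤ))) (B := B) (s ⟨k, hkD⟩)
      (fun j hj1 hj2 => ?_)).trans ?_
    · rw [fwdDiff_line]
      refine h _ (fun i => ?_) _
      have := path_mem_box (p := p) hs ⟨k, hkD⟩ hj1 (hj2.le) i
      simpa using this
    · have : |((s ⟨k, hkD⟩ : ℤ) : ℝ)| ≤ (R : ℝ) := by exact_mod_cast hs ⟨k, hkD⟩
      exact mul_le_mul_of_nonneg_right this hB
  calc ∑ k ∈ range D, |f (p + trunc (k + 1) s) - f (p + trunc k s)| ≤ ∑ _k ∈ range D, (R : ℝ) * B := sum_le_sum hk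
    _ = (D : ℝ) * (R : ℝ) * B := by rw [sum_const, card_range, nsmul_eq_mul]; ring


/-- [folklore] The coordinate-path telescoping indexed by `Fin D`. -/
theorem sub_eq_sum_path_fin : f (p + s) - f p = ∑ k : Fin D, (f (p + trunc ((k : ℕ) + 1) s) - f (p + trunc k s)) := by
  rw [sub_eq_sum_path, ← Fin.sum_univ_eq_sum_range (fun k => f (p + trunc (k + 1) s) - f (p + trunc k s))]

/-- **FIRST-ORDER BOUND ON `ℤ^D`**: if every second difference `Δ_i Δ_j f` is bounded by `B` on the coordinate box of radius `R` around `p` and `|s_i| ≤ R`,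
then `|f (p + s) − f p − Σ_i s_i·Δ_i f p| ≤ D(D+1)·R²·B`. [folklore] -/
theorem abs_taylor1D_le {R : ℕ} (hs : ∀ i, |s i| ≤ (R : ℤ)) {B : ℝ} (hB : 0 ≤ B)
    (h : ∀ x : Fin D → ℤ, (∀ i, |x i - p i| ≤ (R : ℤ)) →
      ∀ i j : Fin D, |Δ_[(Pi.single i 1 : Fin D → ℤ)] (Δ_[(Pi.single j 1 : Fin D → ℤ)] f) x| ≤ B) :
    |f (p + s) - f p - ∑ i : Fin D, (s i : ℝ) * Δ_[(Pi.single i 1 : Fin D → ℤ)] f p|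
      ≤ (D : ℝ) * ((D : ℝ) + 1) * (R : ℝ) ^ 2 * B := by
  rw [sub_eq_sum_path_fin, ← Finset.sum_sub_distrib]
  refine (abs_sum_le_sum_abs _ _).trans ?_
  have hR : (0 : ℝ) ≤ R := Nat.cast_nonneg R
  have hk : ∀ k : Fin D, |f (p + trunc ((k : ℕ) + 1) s) - f (p + trunc k s) - (s k : ℝ) * Δ_[(Pi.single k 1 : Fin D → ℤ)] f p|
      ≤ (R : ℝ) ^ 2 * B + (R : ℝ) * ((D : ℝ) * (R : ℝ) * B) := by
    intro k
    have hsk : |((s k : ℤ) : ℝ)| ≤ (R : ℝ) := by exact_mod_cast hs k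
    -- the 1D first-order remainder along `e_k`
    have h1 := abs_taylor1_le (fun j : ℤ => f (p + trunc k s + j • (Pi.single k 1 : Fin D → ℤ))) hB (s k) (fun j hj1 hj2 => by
      rw [fwdDiff_fwdDiff_line]
      exact h _ (fun i => path_mem_box (p := p) hs k hj1 hj2.le i) k k)
    rw [fwdDiff_line] at h1
    simp only [zero_smul, add_zero] at h1
    -- the zeroth-order expansion of `Δ_k f` from `p` to `p + trunc k s`
    have h0 := abs_taylor0D_le (Δ_[(Pi.single k 1 : Fin D → ℤ)] f) p (trunc k s) (R := R)
      (fun i => (abs_trunc_le k s i).trans (hs i)) hB (fun x hx i => h x hx i k)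
    rw [path_step_eq]
    simp only [zero_smul, add_zero]
    have e : f (p + trunc k s + s k • (Pi.single k 1 : Fin D → ℤ)) - f (p + trunc k s)
          - (s k : ℝ) * Δ_[(Pi.single k 1 : Fin D → ℤ)] f p
        = (f (p + trunc k s + s k • (Pi.single k 1 : Fin D → ℤ)) - f (p + trunc k s)
            - (s k : ℝ) * Δ_[(Pi.single k 1 : Fin D → ℤ)] f (p + trunc k s))
          + (s k : ℝ) * (Δ_[(Pi.single k 1 : Fin D → ℤ)] f (p + trunc k s) - Δ_[(Pi.single k 1 : Fin D → ℤ)] f p) := by ring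
    rw [e]
    refine (abs_add_le _ _).trans (add_le_add ?_ ?_)
    · refine h1.trans ?_
      have : ((s k : ℤ) : ℝ) ^ 2 ≤ (R : ℝ) ^ 2 := by
        rw [← sq_abs]; exact pow_le_pow_left₀ (abs_nonneg _) hsk 2
      exact mul_le_mul_of_nonneg_right this hB
    · rw [abs_mul]
      exact mul_le_mul hsk h0 (abs_nonneg _) hR
  calc ∑ k : Fin D, |f (p + trunc ((k : ℕ) + 1) s) - f (p + trunc k s) - (s k : ℝ) * Δ_[(Pi.single k 1 : Fin D → ℤ)] f p|
      ≤ ∑ _k : Fin D, ((R : ℝ) ^ 2 * B + (R : ℝ) * ((D : ℝ) * (R : ℝ) * B)) := sum_le_sum fun k _ => hk k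
    _ = (D : ℝ) * ((D : ℝ) + 1) * (R : ℝ) ^ 2 * B := by rw [sum_const, Finset.card_univ, Fintype.card_fin, nsmul_eq_mul]; ring


/-- [folklore] The second Taylor coefficient is at most `R²` on `|m| ≤ R`: `|m(m−1)/2| ≤ R²`. -/
theorem abs_choose2_le {m : ℤ} {R : ℕ} (hm : |m| ≤ (R : ℤ)) : |((m : ℝ) * ((m : ℝ) - 1) / 2)| ≤ (R : ℝ) ^ 2 := by
  have hmR : |(m : ℝ)| ≤ (R : ℝ) := by exact_mod_cast hm
  have hR : (0 : ℝ) ≤ R := Nat.cast_nonneg R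
  rw [abs_le] at hmR
  rw [abs_le]
  rcases Nat.eq_zero_or_pos R with h0 | h0
  · subst h0
    have : (m : ℝ) = 0 := by push_cast at hmR; linarith [hmR.1, hmR.2]
    simp [this]
  · have h1 : (1 : ℝ) ≤ R := by exact_mod_cast h0
    constructor <;> nlinarith [hmR.1, hmR.2]

/-- **SECOND-ORDER BOUND ON `ℤ^D`**: if every third difference `Δ_i Δ_j Δ_k f` is bounded by `B` on the coordinate box of radius `R` around `p` and `|s_i| ≤ R`, then
`|f (p + s) − f p − Σ_k s_k·Δ_k f p − Σ_k (s_k(s_k−1)/2)·Δ_kΔ_k f p − Σ_k Σ_i s_k·(trunc k s)_i·Δ_iΔ_k f p| ≤ D(D+1)²·R³·B` — the discrete Taylor polynomial of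
order two along the coordinate path (mixed term over `i < k`, encoded by `trunc`), forward differences AT THE BASE POINT only. [folklore] -/
theorem abs_taylor2D_le {R : ℕ} (hs : ∀ i, |s i| ≤ (R : ℤ)) {B : ℝ} (hB : 0 ≤ B)
    (h : ∀ x : Fin D → ℤ, (∀ i, |x i - p i| ≤ (R : ℤ)) → ∀ i j k : Fin D,
      |Δ_[(Pi.single i 1 : Fin D → ℤ)] (Δ_[(Pi.single j 1 : Fin D → ℤ)] (Δ_[(Pi.single k 1 : Fin D → ℤ)] f)) x| ≤ B) :
    |f (p + s) - f p - ∑ k : Fin D, (s k : ℝ) * Δ_[(Pi.single k 1 : Fin D → ℤ)] f p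
        - ∑ k : Fin D, ((s k : ℝ) * ((s k : ℝ) - 1) / 2) * Δ_[(Pi.single k 1 : Fin D → ℤ)] (Δ_[(Pi.single k 1 : Fin D → ℤ)] f) p
        - ∑ k : Fin D, ∑ i : Fin D, (s k : ℝ) * (trunc k s i : ℝ) * Δ_[(Pi.single i 1 : Fin D → ℤ)] (Δ_[(Pi.single k 1 : Fin D → ℤ)] f) p|
      ≤ (D : ℝ) * ((D : ℝ) + 1) ^ 2 * (R : ℝ) ^ 3 * B := by
  rw [sub_eq_sum_path_fin, ← Finset.sum_sub_distrib, ← Finset.sum_sub_distrib, ← Finset.sum_sub_distrib]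
  refine (abs_sum_le_sum_abs _ _).trans ?_
  have hR : (0 : ℝ) ≤ R := Nat.cast_nonneg R
  have hk : ∀ k : Fin D,
      |f (p + trunc ((k : ℕ) + 1) s) - f (p + trunc k s) - (s k : ℝ) * Δ_[(Pi.single k 1 : Fin D → ℤ)] f p
          - ((s k : ℝ) * ((s k : ℝ) - 1) / 2) * Δ_[(Pi.single k 1 : Fin D → ℤ)] (Δ_[(Pi.single k 1 : Fin D → ℤ)] f) p
          - ∑ i : Fin D, (s k : ℝ) * (trunc k s i : ℝ) * Δ_[(Pi.single i 1 : Fin D → ℤ)] (Δ_[(Pi.single k 1 : Fin D → ℤ)] f) p|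
        ≤ (R : ℝ) ^ 3 * B + (R : ℝ) * ((D : ℝ) * ((D : ℝ) + 1) * (R : ℝ) ^ 2 * B) + (R : ℝ) ^ 2 * ((D : ℝ) * (R : ℝ) * B) := by
    intro k
    have hsk : |((s k : ℤ) : ℝ)| ≤ (R : ℝ) := by exact_mod_cast hs k
    -- (i) the 1D second-order remainder along `e_k`
    have h2 := abs_taylor2_le (fun j : ℤ => f (p + trunc k s + j • (Pi.single k 1 : Fin D → ℤ))) hB (s k) (fun j hj1 hj2 => by
      rw [fwdDiff_fwdDiff_fwdDiff_line]
      exact h _ (fun i => path_mem_box (p := p) hs k hj1 hj2.le i) k k k)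
    rw [fwdDiff_fwdDiff_line, fwdDiff_line] at h2
    simp only [zero_smul, add_zero] at h2
    -- (ii) the first-order expansion of `Δ_k f` from `p` to `p + trunc k s`
    have h1 := abs_taylor1D_le (Δ_[(Pi.single k 1 : Fin D → ℤ)] f) p (trunc k s) (R := R)
      (fun i => (abs_trunc_le k s i).trans (hs i)) hB (fun x hx i j => h x hx i j k)
    -- (iii) the zeroth-order expansion of `Δ_k Δ_k f` from `p` to `p + trunc k s`
    have h0 := abs_taylor0D_le (Δ_[(Pi.single k 1 : Fin D → ℤ)] (Δ_[(Pi.single k 1 : Fin D → ℤ)] f)) p (trunc k s) (R := R)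
      (fun i => (abs_trunc_le k s i).trans (hs i)) hB (fun x hx i => h x hx i k k)
    rw [path_step_eq]
    simp only [zero_smul, add_zero]
    -- abbreviations for the algebra
    set F1 := f (p + trunc k s + s k • (Pi.single k 1 : Fin D → ℤ)) with hF1
    set F0 := f (p + trunc k s) with hF0
    set d1q := Δ_[(Pi.single k 1 : Fin D → ℤ)] f (p + trunc k s) with hd1q
    set d1p := Δ_[(Pi.single k 1 : Fin D → ℤ)] f p with hd1p
    set d2q := Δ_[(Pi.single k 1 : Fin D → ℤ)] (Δ_[(Pi.single k 1 : Fin D → ℤ)] f) (p + trunc k s) with hd2q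
    set d2p := Δ_[(Pi.single k 1 : Fin D → ℤ)] (Δ_[(Pi.single k 1 : Fin D → ℤ)] f) p with hd2p
    set L := ∑ i : Fin D, (trunc k s i : ℝ) * Δ_[(Pi.single i 1 : Fin D → ℤ)] (Δ_[(Pi.single k 1 : Fin D → ℤ)] f) p with hL
    have eM : ∑ i : Fin D, (s k : ℝ) * (trunc k s i : ℝ) * Δ_[(Pi.single i 1 : Fin D → ℤ)] (Δ_[(Pi.single k 1 : Fin D → ℤ)] f) p
        = (s k : ℝ) * L := by
      rw [hL, Finset.mul_sum]
      refine Finset.sum_congr rfl fun i _ => ?_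
      ring
    rw [eM]
    have e : F1 - F0 - (s k : ℝ) * d1p - ((s k : ℝ) * ((s k : ℝ) - 1) / 2) * d2p - (s k : ℝ) * L
        = (F1 - F0 - (s k : ℝ) * d1q - ((s k : ℝ) * ((s k : ℝ) - 1) / 2) * d2q)
          + (s k : ℝ) * (d1q - d1p - L) + ((s k : ℝ) * ((s k : ℝ) - 1) / 2) * (d2q - d2p) := by ring
    rw [e]
    refine (abs_add_le _ _).trans (add_le_add ((abs_add_le _ _).trans (add_le_add ?_ ?_)) ?_)
    · refine h2.trans ?_
      have : |((s k : ℤ) : ℝ)| ^ 3 ≤ (R : ℝ) ^ 3 := pow_le_pow_left₀ (abs_nonneg _) hsk 3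
      exact mul_le_mul_of_nonneg_right this hB
    · rw [abs_mul]
      exact mul_le_mul hsk h1 (abs_nonneg _) hR
    · rw [abs_mul]
      exact mul_le_mul (abs_choose2_le (hs k)) h0 (abs_nonneg _) (by positivity)
  calc ∑ k : Fin D, |f (p + trunc ((k : ℕ) + 1) s) - f (p + trunc k s) - (s k : ℝ) * Δ_[(Pi.single k 1 : Fin D → ℤ)] f p
          - ((s k : ℝ) * ((s k : ℝ) - 1) / 2) * Δ_[(Pi.single k 1 : Fin D → ℤ)] (Δ_[(Pi.single k 1 : Fin D → ℤ)] f) p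
          - ∑ i : Fin D, (s k : ℝ) * (trunc k s i : ℝ) * Δ_[(Pi.single i 1 : Fin D → ℤ)] (Δ_[(Pi.single k 1 : Fin D → ℤ)] f) p|
      ≤ ∑ _k : Fin D, ((R : ℝ) ^ 3 * B + (R : ℝ) * ((D : ℝ) * ((D : ℝ) + 1) * (R : ℝ) ^ 2 * B) + (R : ℝ) ^ 2 * ((D : ℝ) * (R : ℝ) * B)) :=
        sum_le_sum fun k _ => hk k
    _ = (D : ℝ) * ((D : ℝ) + 1) ^ 2 * (R : ℝ) ^ 3 * B := by rw [sum_const, Finset.card_univ, Fintype.card_fin, nsmul_eq_mul]; ring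

end MultiBounds

end Summit.QuantumFields.BalabanUV.Beta.FP.LatticeTaylorPath

end
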